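import Summits.BirchSwinnertonDyer.BirchSwinnertonDyer.Theorems.AdditiveBranchIMCMultLowerCycLineEndState
import HarnessLib

/-!
# Route `AdditiveBranchIMC` (rung K1), crux `MultLower` (item 19359), cell (M), rank 1: the PER-PAIR
# DOORS from PRINTED facts — `BSD(E,p)` / the lower half on X4(M) ∧ surj, X3♯(M) and any (M) row, with the
# analytic input supplied by Disegni's conjoined fact (B) instead of the cell memo hFact

Cell `bsd-addord`, seat `bsd-addord-k1-c4` (gen 4). THEOREMS ONLY (no definition, no named fact, no
`sorry`). Sequel of `…CycLineEndState.lean`: the three per-pair doors of `…RankOneClassCert.lean` §5 with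
hFact (`Disegni2017.delbourgoDatum_rankOne_leadingTerms`, cell memo PROOF-gz) REPLACED by the PRINTED bundle
`hCyc : Disegni2017.delbourgoDatum_cycLineGrossZagier` + `h73 : GrossZagier1986_thm_I_7_3` +
`hWald : waldspurger_exists_heegnerField_twist_ne_zero` + `hmodN : exists_isNewformOf` (Artin formalism and
Pal 2012 being tree theorems), through `potMult_forall_branchPAdicGrossZagierMultAt_of_cycLineFact`:

* `ClassX4M.bsdp_rankOne_of_cycLineFact_of_katoHalf_of_firstUnitIndex_of_budget` — X4(M) ∧ surj(p), the
  index-`n₀` rows of Route G: printed facts + Kato's half `hK` + the census record at `n₀` + the budget + the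
  bit ⟹ `BSD(E,p)` (n1011-p07's capstone `.mpr`); `…_of_firstUnitIndex_one` (unit-certified rows: no budget,
  no separate bit) — the (M) rows' analogue of gz's (G-ord) PROVED-by-name end states;
* `ClassX3M.bsdp_rankOne_of_cycLineFact_of_wuthrichHalf_of_quadraticBranchLower_of_multCoeffOneNeZero` —
  X3♯(M): printed facts + Wuthrich's half + p10's Λ-adic input on the twist models + the bit ⟹ `BSD(E,p)`;
* `potMult_missingLowerBoundAt_rankOne_of_cycLineFact_of_quadraticBranchLower_of_multCoeffOneNeZero` — any
  (M) row: printed facts + Λ-adic input + bit ⟹ the LOWER half (the crux's currency).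

HONEST LABELS: per pair, modulo the displayed named facts (PRINTED) and per-pair inputs outside the kernel
(census record = CERTIFICATE-EVIDENCE, budget, bit; `QuadraticBranchLowerDivisibilityAt` at a multiplicative
`V` is NOT in print); GZ-H binds (see `…CycLineEndState.lean`). Nothing booked by this file.

References: [Kato2004Asterisque] Thm. 17.4 (3); [Wuthrich2014] Thm. 16; [Delbourgo2002] Thm. (A), (B);
[Disegni2017] Thm. A/B, (1.1.3), Rem. 1.3.2; [GrossZagier1986] Thm. I.(7.3); [Miller2011LMS] Def. 1.1.
-/

set_option autoImplicit false
set_option linter.dupNamespace false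

noncomputable section

open scoped Classical MatrixGroups ModularForm NumberField

namespace Summit.BirchSwinnertonDyer.BirchSwinnertonDyer.Theorems.AdditiveBranchIMCMultLower

open CongruenceSubgroup WeierstrassCurve Literature.NumberTheory.EllipticCurves
  Literature.NumberTheory.EllipticCurves.ModularForms
  Literature.NumberTheory.EllipticCurves.Rank1Residual
  Literature.NumberTheory.EllipticCurves.Rank1Residual.Typed
  Literature.NumberTheory.EllipticCurves.Delbourgo2002
  Literature.NumberTheory.EllipticCurves.Disegni2017
  Summit.BirchSwinnertonDyer.Rank1Residual.Additive
  Summit.BirchSwinnertonDyer.Rank1Residual.AdditivePotMult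

variable {W : WeierstrassCurve ℚ} [W.IsElliptic] [W.IsGloballyMinimal] {p : ℕ} [hp : Fact p.Prime]

/-- **Per pair, X4(M) ∧ surj(p), index-`n₀` rows of Route G, `r_an = 1`, EVERY odd `p`: `BSD(E,p)` from
PRINTED facts + Kato's half + the census record at `n₀` + the budget + the bit.** n1011-p07's capstone
`ClassX4M.bsdp_iff_forall_branchPAdicGrossZagierMultAt_of_katoHalf_of_firstUnitIndex_of_budget` `.mpr`, its
right-hand side («the typed (M) `p`-adic Gross–Zagier for every (B)-datum») SUPPLIED by the printed bundle
(`potMult_forall_branchPAdicGrossZagierMultAt_of_cycLineFact`). Inputs: `hK` (Kato 17.4 (3)), `hDelM`,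
`hmod`, `hmodD`, `hmodN`, GZK, `hCyc`, `h73`, `hWald` (by name); per pair the record
`Mult[Odd]FirstUnitIndexAt W p n₀`, `BudgetLeLambdaAt p W n₀`, the bit. GZ-H applies. Per pair; nothing booked.
[cite: Kato2004Asterisque, Thm. 17.4 (3) (p. 273)] [cite: Delbourgo2002, Theorem (A), (B) (p. 40)]
[cite: Disegni2017, Thm. A/B, (1.1.3), Rem. 1.3.2] [cite: GrossZagier1986, Thm. I.(7.3)] [cite: Miller2011LMS, Def. 1.1] -/
theorem ClassX4M.bsdp_rankOne_of_cycLineFact_of_katoHalf_of_firstUnitIndex_of_budget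
    (hCyc : delbourgoDatum_cycLineGrossZagier) (h73 : GrossZagier1986_thm_I_7_3)
    (hWald : waldspurger_exists_heegnerField_twist_ne_zero) (hmodN : exists_isNewformOf)
    (hDelM : Delbourgo2002.mainTheorem_potMult)
    (hK : Wuthrich2014.kato_halfEigenCharIdeal_dvd_cyclotomicPrime_of_surjective)
    (hmod : hasEntireLFunction_rat) (hmodD : nonempty_modularParametrizationData)
    (hGZK : rank_eq_analyticRank_of_analyticRank_le_one)
    (hX : ClassX4M W p) (hsurj : Surj W p) (hr : W.analyticRank = 1) {n₀ : ℕ}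
    (hrec : (p % 4 = 1 → CensusQ6.MultFirstUnitIndexAt W p n₀) ∧
      (p % 4 = 3 → CensusQ6.MultOddFirstUnitIndexAt W p n₀))
    (hbud : BudgetLeLambdaAt p W n₀)
    (hne : ∀ (V : WeierstrassCurve ℚ) [V.IsElliptic] [V.IsGloballyMinimal] (C : VariableChange ℚ),
      Mult V p → C • V.quadraticTwist ((-1 : ℚ) ^ (p / 2) * p) = W →
      ∀ {N : ℕ} [NeZero N] (f : CuspForm (Gamma0 N) 2), IsNewformOf V f → ∀ (ap : ℤ), cuspCoeff f p = ap →
      ∀ ϖ : ℚ, (if Even (p / 2) then (ϖ : ℝ) * V.realPeriodRat = plusPeriod f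
          else (ϖ : ℝ) * V.imaginaryPeriodRat = minusPeriod f) →
        PowerSeries.coeff 1 (PowerSeries.C (ϖ : ℚ_[p]) *
            (if Even (p / 2) then padicLFunctionPlusBranchMult f (ap : ℚ_[p]) (p / 2)
              else padicLFunctionMinusBranchMult f (ap : ℚ_[p]) (p / 2))) ≠ 0) :
    BSDp W p :=
  (hX.bsdp_iff_forall_branchPAdicGrossZagierMultAt_of_katoHalf_of_firstUnitIndex_of_budget hDelM hK hmod
      hmodD hGZK hsurj hr hrec hbud hne).mpr
    (potMult_forall_branchPAdicGrossZagierMultAt_of_cycLineFact hCyc h73 hWald hmodN hmod hmodD hGZK hDelM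
      hX.potMult hX.p_ne_two hr)

/-- **Per pair, X4(M) ∧ surj(p), record at index `1` (the unit-certified rows), `r_an = 1`: `BSD(E,p)` from
PRINTED facts + Kato's half + the index-`1` record** — no budget, no separate bit. The (M) analogue of gz's
(G-ord) PROVED-by-name end states with hFact replaced by print. Per pair; nothing booked.
[cite: Kato2004Asterisque, Thm. 17.4 (3) (p. 273)] [cite: Delbourgo2002, Theorem (A), (B) (p. 40)]
[cite: Disegni2017, Thm. A/B, (1.1.3), Rem. 1.3.2] [cite: GrossZagier1986, Thm. I.(7.3)] -/
theorem ClassX4M.bsdp_rankOne_of_cycLineFact_of_katoHalf_of_firstUnitIndex_one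
    (hCyc : delbourgoDatum_cycLineGrossZagier) (h73 : GrossZagier1986_thm_I_7_3)
    (hWald : waldspurger_exists_heegnerField_twist_ne_zero) (hmodN : exists_isNewformOf)
    (hDelM : Delbourgo2002.mainTheorem_potMult)
    (hK : Wuthrich2014.kato_halfEigenCharIdeal_dvd_cyclotomicPrime_of_surjective)
    (hmod : hasEntireLFunction_rat) (hmodD : nonempty_modularParametrizationData)
    (hGZK : rank_eq_analyticRank_of_analyticRank_le_one)
    (hX : ClassX4M W p) (hsurj : Surj W p) (hr : W.analyticRank = 1)
    (hrec : (p % 4 = 1 → CensusQ6.MultFirstUnitIndexAt W p 1) ∧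
      (p % 4 = 3 → CensusQ6.MultOddFirstUnitIndexAt W p 1)) :
    BSDp W p :=
  (hX.bsdp_iff_forall_branchPAdicGrossZagierMultAt_of_katoHalf_of_firstUnitIndex_one hDelM hK hmod hmodD
      hGZK hsurj hr hrec).mpr
    (potMult_forall_branchPAdicGrossZagierMultAt_of_cycLineFact hCyc h73 hWald hmodN hmod hmodD hGZK hDelM
      hX.potMult hX.p_ne_two hr)

/-- **Per pair, X3♯(M), `r_an = 1`, EVERY odd `p`: `BSD(E,p)` from PRINTED facts + Wuthrich's half +
p10's Λ-adic input on the twist models + the bit** — n1011's loop-closing iff `.mpr` with its rider `hSall`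
discharged by the bit (Schneider from the typed identity) and its right-hand side supplied by the printed
bundle. Per pair; nothing booked. [cite: Wuthrich2014, Thm. 16 (p. 397)] [cite: Delbourgo2002, Theorem (A), (B) (p. 40)]
[cite: Disegni2017, Thm. A/B, (1.1.3), Rem. 1.3.2] [cite: GrossZagier1986, Thm. I.(7.3)] [cite: Miller2011LMS, Def. 1.1] -/
theorem ClassX3M.bsdp_rankOne_of_cycLineFact_of_wuthrichHalf_of_quadraticBranchLower_of_multCoeffOneNeZero
    (hCyc : delbourgoDatum_cycLineGrossZagier) (h73 : GrossZagier1986_thm_I_7_3)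
    (hWald : waldspurger_exists_heegnerField_twist_ne_zero) (hmodN : exists_isNewformOf)
    (hDelM : Delbourgo2002.mainTheorem_potMult)
    (hW16 : Wuthrich2014.thm16_halfEigenCharIdeal_dvd_cyclotomicPrime)
    (hmod : hasEntireLFunction_rat) (hmodD : nonempty_modularParametrizationData)
    (hGZK : rank_eq_analyticRank_of_analyticRank_le_one) (hX : ClassX3M W p) (hr : W.analyticRank = 1)
    (hc : ∀ (V : WeierstrassCurve ℚ) [V.IsElliptic] [V.IsGloballyMinimal],
      (∃ C : VariableChange ℚ, C • V.quadraticTwist ((-1) ^ (p / 2) * p : ℚ) = W) →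
        QuadraticBranchLowerDivisibilityAt V p)
    (hne : ∀ (V : WeierstrassCurve ℚ) [V.IsElliptic] [V.IsGloballyMinimal] (C : VariableChange ℚ),
      Mult V p → C • V.quadraticTwist ((-1 : ℚ) ^ (p / 2) * p) = W →
      ∀ {N : ℕ} [NeZero N] (f : CuspForm (Gamma0 N) 2), IsNewformOf V f → ∀ (ap : ℤ), cuspCoeff f p = ap →
      ∀ ϖ : ℚ, (if Even (p / 2) then (ϖ : ℝ) * V.realPeriodRat = plusPeriod f
          else (ϖ : ℝ) * V.imaginaryPeriodRat = minusPeriod f) →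
        PowerSeries.coeff 1 (PowerSeries.C (ϖ : ℚ_[p]) *
            (if Even (p / 2) then padicLFunctionPlusBranchMult f (ap : ℚ_[p]) (p / 2)
              else padicLFunctionMinusBranchMult f (ap : ℚ_[p]) (p / 2))) ≠ 0) :
    BSDp W p := by
  have hGZall := potMult_forall_branchPAdicGrossZagierMultAt_of_cycLineFact hCyc h73 hWald hmodN hmod hmodD
    hGZK hDelM hX.potMult hX.p_ne_two hr
  obtain ⟨V, iV, iVm, C, hV, hC⟩ := hX.potMult.exists_mult_pStar_twist_model hX.p_ne_two
  exact (hX.bsdp_iff_forall_branchPAdicGrossZagierMultAt_of_quadraticBranchLower_of_wuthrichHalf hDelM hW16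
      hmod hmodD hGZK hr hc fun Dh hB ↦
        schneiderConjecture_of_branchPAdicGrossZagierMultAt_of_multCoeffOneNeZero hX.p_ne_two hmodD hGZK hr
          (hGZall Dh hB) hne V C hV hC).mpr hGZall

/-- **Per pair, ANY (M) row (X3♯(M), X4(M), surjective or not), `r_an = 1`, EVERY odd `p`: the LOWER half
from PRINTED facts, p10's Λ-adic input on the twist models of THIS pair, and the bit** — the tree's
`PotMult.missingLowerBoundAt_rankOne_of_quadraticBranchLower_of_branchPAdicGrossZagierMult` with its ∀-datum
binder discharged by the printed bundle (the typed identity) and the bit (Schneider). No image hypothesis.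
Conditional; nothing booked. [cite: Delbourgo2002, Theorem (A), (B) (p. 40)]
[cite: Disegni2017, Thm. A/B, (1.1.3), Rem. 1.3.2] [cite: GrossZagier1986, Thm. I.(7.3)] [cite: Miller2011LMS, Def. 1.1] -/
theorem potMult_missingLowerBoundAt_rankOne_of_cycLineFact_of_quadraticBranchLower_of_multCoeffOneNeZero
    (hCyc : delbourgoDatum_cycLineGrossZagier) (h73 : GrossZagier1986_thm_I_7_3)
    (hWald : waldspurger_exists_heegnerField_twist_ne_zero) (hmodN : exists_isNewformOf)
    (hDelM : Delbourgo2002.mainTheorem_potMult)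
    (hmod : hasEntireLFunction_rat) (hmodD : nonempty_modularParametrizationData)
    (hGZK : rank_eq_analyticRank_of_analyticRank_le_one)
    (hpm : Summit.BirchSwinnertonDyer.Rank1Residual.AdditivePotMult.PotMult W p) (hp2 : p ≠ 2)
    (hr : W.analyticRank = 1)
    (hc : ∀ (V : WeierstrassCurve ℚ) [V.IsElliptic] [V.IsGloballyMinimal],
      (∃ C : VariableChange ℚ, C • V.quadraticTwist ((-1) ^ (p / 2) * p : ℚ) = W) →
        QuadraticBranchLowerDivisibilityAt V p)
    (hne : ∀ (V : WeierstrassCurve ℚ) [V.IsElliptic] [V.IsGloballyMinimal] (C : VariableChange ℚ),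
      Mult V p → C • V.quadraticTwist ((-1 : ℚ) ^ (p / 2) * p) = W →
      ∀ {N : ℕ} [NeZero N] (f : CuspForm (Gamma0 N) 2), IsNewformOf V f → ∀ (ap : ℤ), cuspCoeff f p = ap →
      ∀ ϖ : ℚ, (if Even (p / 2) then (ϖ : ℝ) * V.realPeriodRat = plusPeriod f
          else (ϖ : ℝ) * V.imaginaryPeriodRat = minusPeriod f) →
        PowerSeries.coeff 1 (PowerSeries.C (ϖ : ℚ_[p]) *
            (if Even (p / 2) then padicLFunctionPlusBranchMult f (ap : ℚ_[p]) (p / 2)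
              else padicLFunctionMinusBranchMult f (ap : ℚ_[p]) (p / 2))) ≠ 0) :
    MissingLowerBoundAt W p := by
  have hGZall := potMult_forall_branchPAdicGrossZagierMultAt_of_cycLineFact hCyc h73 hWald hmodN hmod hmodD
    hGZK hDelM hpm hp2 hr
  obtain ⟨V, iV, iVm, C, hV, hC⟩ := hpm.exists_mult_pStar_twist_model hp2
  exact hpm.missingLowerBoundAt_rankOne_of_quadraticBranchLower_of_branchPAdicGrossZagierMult hDelM hmod hmodD
    hGZK hp2 hr hc fun Dh hB ↦
      ⟨schneiderConjecture_of_branchPAdicGrossZagierMultAt_of_multCoeffOneNeZero hp2 hmodD hGZK hr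
          (hGZall Dh hB) hne V C hV hC,
        hGZall Dh hB⟩

/-- **(M), `r_an ≤ 1`: the typed (M) `p`-adic Gross–Zagier for EVERY height datum with Delbourgo's clauses,
from PRINTED facts** — rank `0` is the tree THEOREM `branchPAdicGrossZagierMultAt_of_analyticRank_eq_zero`
(Birch + one-term constant terms; no height), rank `1` is `potMult_forall_branchPAdicGrossZagierMultAt_of_cycLineFact`.
[cite: MazurTateTeitelbaum1986Invent, §I.8, §I.10, §I.13–I.14] [cite: Disegni2017, Thm. A/B, (1.1.3), Rem. 1.3.2]
[cite: Delbourgo2002, Theorem (A), (B) (p. 40)] -/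
theorem potMult_forall_branchPAdicGrossZagierMultAt_rankLeOne_of_cycLineFact
    (hCyc : delbourgoDatum_cycLineGrossZagier) (h73 : GrossZagier1986_thm_I_7_3)
    (hWald : waldspurger_exists_heegnerField_twist_ne_zero) (hmodN : exists_isNewformOf)
    (hDelM : Delbourgo2002.mainTheorem_potMult)
    (hmod : hasEntireLFunction_rat) (hmodD : nonempty_modularParametrizationData)
    (hGZK : rank_eq_analyticRank_of_analyticRank_le_one)
    (hpm : Summit.BirchSwinnertonDyer.Rank1Residual.AdditivePotMult.PotMult W p) (hp2 : p ≠ 2)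
    (hr : W.analyticRank ≤ 1) (Dh : PAdicHeightData W p) (hB : LeadingTermClauses W p Dh) :
    BranchPAdicGrossZagierMultAt W p Dh := by
  rcases Nat.le_one_iff_eq_zero_or_eq_one.mp hr with h0 | h1
  · exact branchPAdicGrossZagierMultAt_of_analyticRank_eq_zero W p hmod hGZK hpm.1 h0 Dh
  · exact potMult_forall_branchPAdicGrossZagierMultAt_of_cycLineFact hCyc h73 hWald hmodN hmod hmodD hGZK
      hDelM hpm hp2 h1 Dh hB

/-- **The registered stub `stub_rankOne` of crux 19359, verbatim, MODULO printed facts, the rank-1 part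
of 19590 and the (M) class certificate.** `∀ W p, r_an = 1 → N10.CellM W p → MissingLowerBoundAt W p` ⟸
Delbourgo 2002 (M), modularity, `hmodD`, GZK, the printed GZ bundle (`hCyc`, `h73`, `hWald`, `hmodN`),
p10's Λ-adic input on the twist models of every rank-1 (M) pair (item 19590 read on the rank-1 pairs) and
the class certificate. p419598 §2 with its ∀-datum binder `hGZ` DISCHARGED by
`multSchneiderNondegeneracy_of_cycLineFact_of_classCert` and `multBranchPAdicGrossZagierAt_of_cycLineFact`.
Conditional; nothing booked. [cite: Delbourgo2002, Theorem (A), (B) (p. 40)]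
[cite: Disegni2017, Thm. A/B, (1.1.3), Rem. 1.3.2] [cite: GrossZagier1986, Thm. I.(7.3)] [cite: Miller2011LMS, Def. 1.1] -/
theorem stub_rankOne_of_facts_of_cycLineFact_of_quadraticBranchLower_of_classCert
    (hCyc : delbourgoDatum_cycLineGrossZagier) (h73 : GrossZagier1986_thm_I_7_3)
    (hWald : waldspurger_exists_heegnerField_twist_ne_zero) (hmodN : exists_isNewformOf)
    (hDelM : Delbourgo2002.mainTheorem_potMult)
    (hmod : hasEntireLFunction_rat) (hmodD : nonempty_modularParametrizationData)
    (hGZK : rank_eq_analyticRank_of_analyticRank_le_one)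
    (hΛ₁ : ∀ (W : WeierstrassCurve ℚ) [W.IsElliptic] [W.IsGloballyMinimal] (p : ℕ) [Fact p.Prime],
      N10.CellM W p → W.analyticRank = 1 →
      ∀ (V : WeierstrassCurve ℚ) [V.IsElliptic] [V.IsGloballyMinimal],
        (∃ C : VariableChange ℚ, C • V.quadraticTwist ((-1) ^ (p / 2) * p : ℚ) = W) →
          QuadraticBranchLowerDivisibilityAt V p)
    (hCert : ∀ (W : WeierstrassCurve ℚ) [W.IsElliptic] [W.IsGloballyMinimal] (p : ℕ) [Fact p.Prime],
      N10.CellM W p → W.analyticRank = 1 →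
      ∀ (V : WeierstrassCurve ℚ) [V.IsElliptic] [V.IsGloballyMinimal] (C : VariableChange ℚ),
        Mult V p → C • V.quadraticTwist ((-1 : ℚ) ^ (p / 2) * p) = W →
        ∀ {N : ℕ} [NeZero N] (f : CuspForm (Gamma0 N) 2), IsNewformOf V f → ∀ (ap : ℤ), cuspCoeff f p = ap →
        ∀ ϖ : ℚ, (if Even (p / 2) then (ϖ : ℝ) * V.realPeriodRat = plusPeriod f
            else (ϖ : ℝ) * V.imaginaryPeriodRat = minusPeriod f) →
          PowerSeries.coeff 1 (PowerSeries.C (ϖ : ℚ_[p]) *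
              (if Even (p / 2) then padicLFunctionPlusBranchMult f (ap : ℚ_[p]) (p / 2)
                else padicLFunctionMinusBranchMult f (ap : ℚ_[p]) (p / 2))) ≠ 0) :
    ∀ (W : WeierstrassCurve ℚ) [W.IsElliptic] [W.IsGloballyMinimal] (p : ℕ) [Fact p.Prime],
      W.analyticRank = 1 → N10.CellM W p → MissingLowerBoundAt W p :=
  multLower_rankOne_of_facts_of_quadraticBranchLower_of_branchPAdicGrossZagierMult hDelM hmod hmodD hGZK hΛ₁
    fun W _ _ p _ hcM hr Dh hB ↦
      ⟨multSchneiderNondegeneracy_of_cycLineFact_of_classCert hCyc h73 hWald hmodN hmod hmodD hGZK hDelM hCert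
          W p hcM hr Dh hB,
        multBranchPAdicGrossZagierAt_of_cycLineFact hCyc h73 hWald hmodN hmod hmodD hGZK hDelM W p hcM hr Dh hB⟩

end Summit.BirchSwinnertonDyer.BirchSwinnertonDyer.Theorems.AdditiveBranchIMCMultLower

end
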